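import Mathlib
import Summits.Ventures.PercRepro2.TypedMarkedSeriesDefs
import Summits.Ventures.PercRepro2.TypedMarkedSeriesGraph

/-!
# Marked series vertices of degree two: the state lemma of rule A (blind cell PercRepro2,
night-3 g13, 2026-08-27; `proofs/NIGHT3-CERT.md` §22)

`st_modelA`: when `o` carries exactly the edges `e = {a₁, o}` (bit `p`) and `f = {o, a₃}` (bit
`a`), the state of `x[e ↦ p][f ↦ a]` is `modelA` of the signature of `x[e ↦ closed][f ↦ closed]`
— the seven coordinates by `conn_off_mid` (connections off `o`) and `conn_mid_iff` (`o` itself).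
-/

namespace Summit.Ventures.PercRepro2

open UnionCluster

namespace CovForm

namespace MarkedSeries

open OneTyped TypedA3 Untouched TypedRed

/-! ## The state lemmas -/

section StateLemmas

open Classical

variable {V : Type*} {E : Type*} [DecidableEq E]
variable (ends : E → Sym2 V) (o a₁ a₂ a₃ b : V)

/-- **State lemma A**: `o` with exactly the edges `e = {a₁, o}` and `f = {o, a₃}`. -/
lemma st_modelA {e f : E} (hef : e ≠ f) (he : ends e = s(a₁, o)) (hf : ends f = s(o, a₃))
    (ho1 : o ≠ a₁) (ho2 : o ≠ a₂) (ho3 : o ≠ a₃) (hob : o ≠ b) (x : Config E)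
    (hother : ∀ e', e' ≠ e → e' ≠ f → o ∈ ends e' → x e' = false) (p a : Bool) :
    st ends o a₁ a₂ a₃ b (Function.update (Function.update x e p) f a) =
      modelA (decide (Conn ends (Function.update (Function.update x e false) f false) a₁ a₂))
        (decide (Conn ends (Function.update (Function.update x e false) f false) a₁ b))
        (decide (Conn ends (Function.update (Function.update x e false) f false) a₁ a₃))
        (decide (Conn ends (Function.update (Function.update x e false) f false) a₂ b))
        (decide (Conn ends (Function.update (Function.update x e false) f false) a₂ a₃))
        (decide (Conn ends (Function.update (Function.update x e false) f false) b a₃)) p a := by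
  have off := fun {s t : V} (hs : s ≠ o) (ht : t ≠ o) =>
    conn_off_mid hef he hf ho1 ho3 x hother p a hs ht
  have mid := fun {s : V} (hs : s ≠ o) => conn_mid_iff hef he hf ho1 ho3 x hother p a hs
  set x₀ := Function.update (Function.update x e false) f false with hx₀
  set x' := Function.update (Function.update x e p) f a with hx'
  have r1 : Conn ends x₀ a₁ a₁ := conn_refl ends x₀ a₁
  have r3 : Conn ends x₀ a₃ a₃ := conn_refl ends x₀ a₃
  have r1' : Conn ends x' a₁ a₁ := conn_refl ends x' a₁
  have s21 : Conn ends x₀ a₂ a₁ ↔ Conn ends x₀ a₁ a₂ := ⟨conn_symm, conn_symm⟩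
  have sb1 : Conn ends x₀ b a₁ ↔ Conn ends x₀ a₁ b := ⟨conn_symm, conn_symm⟩
  have s31 : Conn ends x₀ a₃ a₁ ↔ Conn ends x₀ a₁ a₃ := ⟨conn_symm, conn_symm⟩
  have s32 : Conn ends x₀ a₃ a₂ ↔ Conn ends x₀ a₂ a₃ := ⟨conn_symm, conn_symm⟩
  have s3b : Conn ends x₀ a₃ b ↔ Conn ends x₀ b a₃ := ⟨conn_symm, conn_symm⟩
  have hoff21 := off ho2.symm ho1.symm
  have hoff1b := off ho1.symm hob.symm
  have hoff2b := off ho2.symm hob.symm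
  have hoff13 := off ho1.symm ho3.symm
  have hoff23 := off ho2.symm ho3.symm
  have hmid1 := mid ho1.symm
  have hmid2 := mid ho2.symm
  simp only [st, modelA, Prod.mk.injEq]
  refine ⟨?_, ?_, ?_, ?_, ?_, ?_, ?_⟩
  · apply Bool.eq_iff_iff.mpr
    simp only [decide_eq_true_eq, Bool.or_eq_true, Bool.and_eq_true]
    simp only [hoff21, s21, r1, true_or, and_true]
    constructor
    · rintro (h | ⟨hm, h | h⟩)
      · exact Or.inl h
      · exact Or.inl h
      · exact Or.inr ⟨hm, h⟩
    · rintro (h | ⟨hm, h⟩)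
      · exact Or.inl h
      · exact Or.inr ⟨hm, Or.inr h⟩
  · apply Bool.eq_iff_iff.mpr
    simp only [decide_eq_true_eq, Bool.or_eq_true, Bool.and_eq_true]
    simp only [hmid1, hoff13, r1, r1', r3, true_or, or_true, and_true]
  · apply Bool.eq_iff_iff.mpr
    simp only [decide_eq_true_eq, Bool.or_eq_true, Bool.and_eq_true]
    simp only [hmid2, hoff21, hoff23, s21, r1, r3, true_or, or_true, and_true]
    constructor
    · rintro (⟨hp, h | ⟨hm, h | h⟩⟩ | ⟨ha, h | ⟨hm, h | h⟩⟩)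
      · exact Or.inl ⟨hp, Or.inl h⟩
      · exact Or.inl ⟨hp, Or.inl h⟩
      · exact Or.inl ⟨hp, Or.inr ⟨hm, h⟩⟩
      · exact Or.inr ⟨ha, Or.inl h⟩
      · exact Or.inr ⟨ha, Or.inr ⟨hm, h⟩⟩
      · exact Or.inr ⟨ha, Or.inl h⟩
    · rintro (⟨hp, h | ⟨hm, h⟩⟩ | ⟨ha, h | ⟨hm, h⟩⟩)
      · exact Or.inl ⟨hp, Or.inl h⟩
      · exact Or.inl ⟨hp, Or.inr ⟨hm, Or.inr h⟩⟩
      · exact Or.inr ⟨ha, Or.inl h⟩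
      · exact Or.inr ⟨ha, Or.inr ⟨hm, Or.inl h⟩⟩
  · apply Bool.eq_iff_iff.mpr
    simp only [decide_eq_true_eq, Bool.or_eq_true, Bool.and_eq_true]
    simp only [hoff1b, sb1, r1, true_or, true_and]
    constructor
    · rintro (h | ⟨hm, h | h⟩)
      · exact Or.inl h
      · exact Or.inl h
      · exact Or.inr ⟨hm, h⟩
    · rintro (h | ⟨hm, h⟩)
      · exact Or.inl h
      · exact Or.inr ⟨hm, Or.inr h⟩
  · apply Bool.eq_iff_iff.mpr
    simp only [decide_eq_true_eq, Bool.or_eq_true, Bool.and_eq_true]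
    simp only [hoff2b, s21, sb1]
    constructor
    · rintro (h | ⟨hm, h1, h2⟩)
      · exact Or.inl h
      · exact Or.inr ⟨⟨hm, h1⟩, h2⟩
    · rintro (h | ⟨⟨hm, h1⟩, h2⟩)
      · exact Or.inl h
      · exact Or.inr ⟨hm, h1, h2⟩
  · apply Bool.eq_iff_iff.mpr
    simp only [decide_eq_true_eq, Bool.or_eq_true, Bool.and_eq_true]
    simp only [hoff13, r1, r3, true_or, or_true, and_true]
  · apply Bool.eq_iff_iff.mpr
    simp only [decide_eq_true_eq, Bool.or_eq_true, Bool.and_eq_true]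
    simp only [hoff23, s21, r3, or_true, and_true]
    constructor
    · rintro (h | ⟨hm, h | h⟩)
      · exact Or.inl h
      · exact Or.inr ⟨hm, h⟩
      · exact Or.inl h
    · rintro (h | ⟨hm, h⟩)
      · exact Or.inl h
      · exact Or.inr ⟨hm, Or.inl h⟩

end StateLemmas

end MarkedSeries

end CovForm

end Summit.Ventures.PercRepro2
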